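import Mathlib
import HarnessLib
import Literature.Analysis.FluidPDE.TypeIAncientMild
import Literature.Analysis.FluidPDE.LocalTypeIReverseTools
import Literature.Analysis.FluidPDE.LocalPressureOscillation
import Literature.Analysis.FluidPDE.ClassicalSuitable
import Literature.Analysis.FluidPDE.ClassicalSolutionGlue
import Literature.Analysis.FluidPDE.SuitableWeakInBallTools
import Literature.Analysis.FluidPDE.SuitableWeakPressure
import Literature.Analysis.FluidPDE.LocalEnergyTimeShift

/-!
# `AxisymEndLiouvilleOfFarPastLedger` (stmt-NavierStokesRegularity-14736), 𝒦-route: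
# the pressure package, I: slice estimates and the time integration

Route SymmetryModuliCount. The blow-down driver of the item
(`Theorems/SymmetryModuliCountAxisymEndLiouvilleOfFarPastLedgerDriver.lean`,
`exists_singular_axisymmetric_limit`) consumes a PRESSURE PACKAGE for the Type-I ancient mild class
`A_C` under the far-past ledger: every backward shift `w(· − T)`, `0 < T ≤ 1`, of a `w ∈ A_C` with
ledger constant `K` has a pressure `q` making it a suitable weak solution in the unit parabolic
ball `Q(0, 1)` in Albritton–Barker's class (Def. 2.1), with the UNIFORM bound
`∫_{Q(0,1)} |q|^{3/2} ≤ D₀(C, K)` — the `D`-half of "`A_C ⊂ 𝒦` given the ledger" (item text: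
"pressure/dissipation parts from the local energy inequality + Calderón–Zygmund for the Oseen
pressure").

This file derives the package (`pressurePackage_of_nearFar`) from the NEAR/FAR STRUCTURE of the
classical window pressure of the class — the statement proved for `A_C` by the sibling crux
`FarPastLedger` (Cruxes/FarPastLedger/Lines/uloc_gronwall_transplant.lean, `nearFar_window`:
KNSS smoothing for `∇p`, slice harmonic analysis, pinning of the affine mode by the Oseen identity),
taken here as the hypothesis `hNF`: on the window `(−3, 0)` the classical pressure `p` of `w`
splits on the ball `B₂(0)` at every time `τ` as `p(τ) = c + p₁ + p₂` with
`‖p₁‖₂² ≤ c₀ (C²/(−τ)) ∫_{B₄(0)} ‖w(τ)‖²` and `‖∇p₂‖ ≤ c₀ ∫_{|y| ≥ 3} ‖w(τ,y)‖² |y|⁻⁴` on `B₂(0)`.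

The estimate (slice by slice, then in time):
* near part (Hölder `3/2 = 2·(3/4)`): `∫_{B₁} |p₁|^{3/2} ≤ (∫ p₁²)^{3/4} |B₁|^{1/4} ≤ (4c₀C²K)^{3/4} |B₁|^{1/4} (−τ)^{-3/4}` by the ledger at radius `4`;
* far part (mean value): `|p₂(x) − p₂(0)| ≤ sup_{B₂}‖∇p₂‖ ≤ c₀ · cS · K` by the far-shell sum of the
  unit-ball ledger (`stub_fplFarShell`, `stub_fplCovering`, landed for the crux `FarPastLedger`);
* the ball mean costs a factor `4` (`setLIntegral_rpow_sub_average_le_of_const`, RRS Ex. 15.2);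
* `∫_{-1}^{0} (−τ)^{-3/4} dτ = 4`, so `∫_{Q((−T,0),1)} |p − [p]_{B₁}|^{3/2} ≤ D₀`;
* the shifted classical pair is suitable on a slab around `[−1, 0]` (CKN: classical solutions
  are suitable, `isSuitableWeakSolutionOn_of_contDiffOn`), stays suitable after subtracting the
  continuous ball mean (`IsSuitableWeakSolutionOn.sub_pressure`), and is then in Albritton–Barker's
  class on `Q(0,1)` (`IsSuitableWeakSolutionOn.isSuitableWeakSolutionInBall`).

## References

* D. Albritton, T. Barker, J. Math. Fluid Mech. 21 (2019), Def. 2.1, §3. [AlbrittonBarker2019]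
* G. Koch, N. Nadirashvili, G. Seregin, V. Šverák, Acta Math. 203 (2009), §3–4 (the Oseen
  pressure of bounded mild solutions). [KochNadirashviliSereginSverak2009]
* J. C. Robinson, J. L. Rodrigo, W. Sadowski, *The three-dimensional Navier–Stokes equations*
  (2016), Lemma 15.12, Exercise 15.2. [RobinsonRodrigoSadowski2016]
-/

noncomputable section

-- the summit and its single problem share the name (D-0017 nested layout)
set_option linter.dupNamespace false

open MeasureTheory Set Metric Filter Function TopologicalSpace
open scoped ENNReal NNReal Topology

namespace Summit.NavierStokesRegularity.NavierStokesRegularity.Theorems.AxisymEndLiouvilleOfFarPastLedger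

open Literature.Analysis.FluidPDE
open Summit.NavierStokesRegularity.NavierStokesRegularity.Theorems

/-! ### Slice estimates on the unit ball -/

/-- **Near part** (Hölder): `∫_{B₁} |p₁|^{3/2} ≤ (∫ p₁²)^{3/4} |B₁|^{1/4} ≤ A^{3/4} |B₁|^{1/4}` for
`p₁ ∈ L²(ℝ³)` with `∫ p₁² ≤ A`. [folklore] -/
theorem near_lintegral_le {p₁ : EuclideanSpace ℝ (Fin 3) → ℝ} (hmem : MemLp p₁ 2 volume) {A : ℝ}
    (hle : ∫ x, p₁ x ^ 2 ≤ A) :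
    ∫⁻ x in ball (0 : EuclideanSpace ℝ (Fin 3)) 1, ‖p₁ x‖ₑ ^ (3 / 2 : ℝ) ≤
      ENNReal.ofReal A ^ (3 / 4 : ℝ) * volume (ball (0 : EuclideanSpace ℝ (Fin 3)) 1) ^ (1 / 4 : ℝ) := by
  set μ : Measure (EuclideanSpace ℝ (Fin 3)) := volume.restrict (ball (0 : EuclideanSpace ℝ (Fin 3)) 1)
    with hμ
  have hpq : Real.HolderConjugate (4 / 3 : ℝ) 4 := by
    rw [Real.holderConjugate_iff]; norm_num
  have hfm : AEMeasurable (fun x => ‖p₁ x‖ₑ ^ (3 / 2 : ℝ)) μ :=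
    (hmem.1.aemeasurable.enorm.pow_const _).restrict
  have hH := ENNReal.lintegral_mul_le_Lp_mul_Lq μ hpq hfm aemeasurable_const (g := fun _ => 1)
  simp only [ENNReal.one_rpow, lintegral_const, one_div] at hH
  -- `(‖p₁‖ₑ^{3/2})^{4/3} = ‖p₁‖ₑ²`
  have hpow : ∀ x, (‖p₁ x‖ₑ ^ (3 / 2 : ℝ)) ^ (4 / 3 : ℝ) = ‖p₁ x‖ₑ ^ (2 : ℝ) := fun x => by
    rw [← ENNReal.rpow_mul]; norm_num
  simp only [hpow] at hH
  -- `∫_{B₁} ‖p₁‖ₑ² ≤ ∫ ‖p₁‖ₑ² = ofReal (∫ p₁²) ≤ ofReal A`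
  have h2 : ∫⁻ x, ‖p₁ x‖ₑ ^ (2 : ℝ) ∂μ ≤ ENNReal.ofReal A := by
    have hint : Integrable (fun x => p₁ x ^ 2) volume := hmem.integrable_sq
    calc ∫⁻ x, ‖p₁ x‖ₑ ^ (2 : ℝ) ∂μ ≤ ∫⁻ x, ‖p₁ x‖ₑ ^ (2 : ℝ) := lintegral_mono' Measure.restrict_le_self le_rfl
      _ = ∫⁻ x, ENNReal.ofReal (p₁ x ^ 2) := by
          refine lintegral_congr fun x => ?_
          rw [ENNReal.rpow_two, ← ofReal_norm, Real.norm_eq_abs, ← ENNReal.ofReal_pow (abs_nonneg _),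
            sq_abs]
      _ = ENNReal.ofReal (∫ x, p₁ x ^ 2) :=
          (ofReal_integral_eq_lintegral_ofReal hint (ae_of_all _ fun x => sq_nonneg _)).symm
      _ ≤ ENNReal.ofReal A := ENNReal.ofReal_le_ofReal hle
  calc ∫⁻ x in ball (0 : EuclideanSpace ℝ (Fin 3)) 1, ‖p₁ x‖ₑ ^ (3 / 2 : ℝ)
      ≤ (∫⁻ x, ‖p₁ x‖ₑ ^ (2 : ℝ) ∂μ) ^ (4 / 3 : ℝ)⁻¹ * (μ univ) ^ (4 : ℝ)⁻¹ := by
        rw [hμ, Measure.restrict_apply_univ]; rw [hμ] at hH; simpa [Measure.restrict_apply_univ] using hH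
    _ ≤ ENNReal.ofReal A ^ (3 / 4 : ℝ) * volume (ball (0 : EuclideanSpace ℝ (Fin 3)) 1) ^ (1 / 4 : ℝ) := by
        rw [hμ, Measure.restrict_apply_univ, show (4 / 3 : ℝ)⁻¹ = 3 / 4 by norm_num,
          show (4 : ℝ)⁻¹ = 1 / 4 by norm_num]
        gcongr

/-- **Far part** (mean value inequality on the convex ball `B₂(0)`): if `p₂` is differentiable on
`B₂(0)` with `‖∇p₂‖ ≤ L` there, then `∫_{B₁} |p₂ − p₂(0)|^{3/2} ≤ L^{3/2} |B₁|`. [folklore] -/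
theorem far_lintegral_le {p₂ : EuclideanSpace ℝ (Fin 3) → ℝ} {L : ℝ}
    (hd : ∀ x ∈ ball (0 : EuclideanSpace ℝ (Fin 3)) 2, DifferentiableAt ℝ p₂ x)
    (hb : ∀ x ∈ ball (0 : EuclideanSpace ℝ (Fin 3)) 2, ‖fderiv ℝ p₂ x‖ ≤ L) :
    ∫⁻ x in ball (0 : EuclideanSpace ℝ (Fin 3)) 1, ‖p₂ x - p₂ 0‖ₑ ^ (3 / 2 : ℝ) ≤
      ENNReal.ofReal L ^ (3 / 2 : ℝ) * volume (ball (0 : EuclideanSpace ℝ (Fin 3)) 1) := by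
  have hpt : ∀ x ∈ ball (0 : EuclideanSpace ℝ (Fin 3)) 1, ‖p₂ x - p₂ 0‖ ≤ L := by
    intro x hx
    have hx2 : x ∈ ball (0 : EuclideanSpace ℝ (Fin 3)) 2 := ball_subset_ball (by norm_num) hx
    have h02 : (0 : EuclideanSpace ℝ (Fin 3)) ∈ ball (0 : EuclideanSpace ℝ (Fin 3)) 2 :=
      mem_ball_self (by norm_num)
    have hmv := (convex_ball (0 : EuclideanSpace ℝ (Fin 3)) 2).norm_image_sub_le_of_norm_fderiv_le
      hd hb h02 hx2
    have hx1 : ‖x - 0‖ ≤ 1 := by rw [sub_zero]; exact (mem_ball_zero_iff.1 hx).le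
    have hL : 0 ≤ L := (norm_nonneg _).trans (hb 0 h02)
    calc ‖p₂ x - p₂ 0‖ ≤ L * ‖x - 0‖ := hmv
      _ ≤ L * 1 := mul_le_mul_of_nonneg_left hx1 hL
      _ = L := mul_one L
  calc ∫⁻ x in ball (0 : EuclideanSpace ℝ (Fin 3)) 1, ‖p₂ x - p₂ 0‖ₑ ^ (3 / 2 : ℝ)
      ≤ ∫⁻ _ in ball (0 : EuclideanSpace ℝ (Fin 3)) 1, ENNReal.ofReal L ^ (3 / 2 : ℝ) := by
        refine setLIntegral_mono' measurableSet_ball fun x hx => ?_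
        refine ENNReal.rpow_le_rpow ?_ (by norm_num)
        rw [← ofReal_norm]
        exact ENNReal.ofReal_le_ofReal (hpt x hx)
    _ = ENNReal.ofReal L ^ (3 / 2 : ℝ) * volume (ball (0 : EuclideanSpace ℝ (Fin 3)) 1) := by
        rw [setLIntegral_const]

/-- **The slice oscillation estimate.** If on `B₂(0)` the slice pressure splits as
`p = c + p₁ + p₂` with `∫ p₁² ≤ A` (`p₁ ∈ L²`) and `‖∇p₂‖ ≤ L` on `B₂(0)`, then
`∫_{B₁} |p − [p]_{B₁}|^{3/2} ≤ 4 · 2^{1/2} (A^{3/4} |B₁|^{1/4} + L^{3/2} |B₁|)`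
(the mean costs a factor `4`, RRS Exercise 15.2; `(a+b)^{3/2} ≤ 2^{1/2}(a^{3/2} + b^{3/2})`). [folklore] -/
theorem slice_osc_le {p : EuclideanSpace ℝ (Fin 3) → ℝ}
    (hp : IntegrableOn p (ball (0 : EuclideanSpace ℝ (Fin 3)) 1) volume) {c : ℝ}
    {p₁ p₂ : EuclideanSpace ℝ (Fin 3) → ℝ}
    (hdec : ∀ x ∈ ball (0 : EuclideanSpace ℝ (Fin 3)) 2, p x = c + p₁ x + p₂ x)
    (hmem : MemLp p₁ 2 volume) {A : ℝ} (hle : ∫ x, p₁ x ^ 2 ≤ A) {L : ℝ}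
    (hd : ∀ x ∈ ball (0 : EuclideanSpace ℝ (Fin 3)) 2, DifferentiableAt ℝ p₂ x)
    (hb : ∀ x ∈ ball (0 : EuclideanSpace ℝ (Fin 3)) 2, ‖fderiv ℝ p₂ x‖ ≤ L) :
    ∫⁻ x in ball (0 : EuclideanSpace ℝ (Fin 3)) 1,
        ‖p x - ⨍ y in ball (0 : EuclideanSpace ℝ (Fin 3)) 1, p y‖ₑ ^ (3 / 2 : ℝ) ≤
      4 * (2 ^ (1 / 2 : ℝ) * (ENNReal.ofReal A ^ (3 / 4 : ℝ) *
          volume (ball (0 : EuclideanSpace ℝ (Fin 3)) 1) ^ (1 / 4 : ℝ) +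
        ENNReal.ofReal L ^ (3 / 2 : ℝ) * volume (ball (0 : EuclideanSpace ℝ (Fin 3)) 1))) := by
  set B : Set (EuclideanSpace ℝ (Fin 3)) := ball (0 : EuclideanSpace ℝ (Fin 3)) 1 with hB
  have hB0 : volume B ≠ 0 := (measure_ball_pos volume (0 : EuclideanSpace ℝ (Fin 3)) one_pos).ne'
  have hBtop : volume B ≠ ⊤ := measure_ball_lt_top.ne
  -- the mean costs a factor 4
  have h1 := setLIntegral_rpow_sub_average_le_of_const hB0 hBtop hp (c + p₂ 0)
  refine h1.trans ?_
  gcongr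
  -- pointwise splitting on `B₁ ⊆ B₂`
  have hpt : ∀ x ∈ B, ‖p x - (c + p₂ 0)‖ₑ ^ (3 / 2 : ℝ) ≤
      2 ^ (1 / 2 : ℝ) * (‖p₁ x‖ₑ ^ (3 / 2 : ℝ) + ‖p₂ x - p₂ 0‖ₑ ^ (3 / 2 : ℝ)) := by
    intro x hx
    have hx2 : x ∈ ball (0 : EuclideanSpace ℝ (Fin 3)) 2 := ball_subset_ball (by norm_num) hx
    have e : p x - (c + p₂ 0) = p₁ x + (p₂ x - p₂ 0) := by rw [hdec x hx2]; ring
    rw [e]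
    have htri : ‖p₁ x + (p₂ x - p₂ 0)‖ₑ ≤ ‖p₁ x‖ₑ + ‖p₂ x - p₂ 0‖ₑ := enorm_add_le _ _
    calc ‖p₁ x + (p₂ x - p₂ 0)‖ₑ ^ (3 / 2 : ℝ)
        ≤ (‖p₁ x‖ₑ + ‖p₂ x - p₂ 0‖ₑ) ^ (3 / 2 : ℝ) := ENNReal.rpow_le_rpow htri (by norm_num)
      _ ≤ 2 ^ ((3 / 2 : ℝ) - 1) * (‖p₁ x‖ₑ ^ (3 / 2 : ℝ) + ‖p₂ x - p₂ 0‖ₑ ^ (3 / 2 : ℝ)) :=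
          ENNReal.rpow_add_le_mul_rpow_add_rpow _ _ (by norm_num)
      _ = 2 ^ (1 / 2 : ℝ) * (‖p₁ x‖ₑ ^ (3 / 2 : ℝ) + ‖p₂ x - p₂ 0‖ₑ ^ (3 / 2 : ℝ)) := by
          norm_num
  have hfm : AEMeasurable (fun x => ‖p₁ x‖ₑ ^ (3 / 2 : ℝ)) (volume.restrict B) :=
    (hmem.1.aemeasurable.enorm.pow_const _).restrict
  calc ∫⁻ x in B, ‖p x - (c + p₂ 0)‖ₑ ^ (3 / 2 : ℝ)
      ≤ ∫⁻ x in B, 2 ^ (1 / 2 : ℝ) * (‖p₁ x‖ₑ ^ (3 / 2 : ℝ) + ‖p₂ x - p₂ 0‖ₑ ^ (3 / 2 : ℝ)) :=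
        setLIntegral_mono' measurableSet_ball hpt
    _ = 2 ^ (1 / 2 : ℝ) * ((∫⁻ x in B, ‖p₁ x‖ₑ ^ (3 / 2 : ℝ)) + ∫⁻ x in B, ‖p₂ x - p₂ 0‖ₑ ^ (3 / 2 : ℝ)) := by
        rw [lintegral_const_mul' _ _ (ENNReal.rpow_ne_top_of_nonneg (by norm_num) ENNReal.ofNat_ne_top),
          lintegral_add_left' hfm]
    _ ≤ 2 ^ (1 / 2 : ℝ) * (ENNReal.ofReal A ^ (3 / 4 : ℝ) *
          volume (ball (0 : EuclideanSpace ℝ (Fin 3)) 1) ^ (1 / 4 : ℝ) +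
        ENNReal.ofReal L ^ (3 / 2 : ℝ) * volume (ball (0 : EuclideanSpace ℝ (Fin 3)) 1)) := by
        gcongr
        · exact near_lintegral_le hmem hle
        · exact far_lintegral_le hd hb

/-! ### Integration in time over a unit parabolic ball -/

/-- `∫_{a}^{b} (−τ)^{-3/4} dτ ≤ 4 (b − a)^{1/4}` for `a ≤ b ≤ 0`: the integral is
`4((−a)^{1/4} − (−b)^{1/4})` and `x ↦ x^{1/4}` is subadditive. [folklore] -/
theorem integral_rpow_neg_threeQuarters_le {a b : ℝ} (hab : a ≤ b) (hb : b ≤ 0) :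
    ∫ τ in a..b, (-τ) ^ (-(3 / 4) : ℝ) ≤ 4 * (b - a) ^ (1 / 4 : ℝ) := by
  have hr : (-1 : ℝ) < -(3 / 4) := by norm_num
  have e1 : ∫ τ in a..b, (-τ) ^ (-(3 / 4) : ℝ) = ∫ σ in (-b)..(-a), σ ^ (-(3 / 4) : ℝ) := by
    rw [intervalIntegral.integral_comp_neg fun σ => σ ^ (-(3 / 4) : ℝ)]
  have e3 : ∫ σ in (-b)..(-a), σ ^ (-(3 / 4) : ℝ) =
      ((-a) ^ (-(3 / 4) + 1 : ℝ) - (-b) ^ (-(3 / 4) + 1 : ℝ)) / (-(3 / 4) + 1) :=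
    integral_rpow (Or.inl hr)
  rw [e1, e3]
  have h14 : (-(3 / 4) + 1 : ℝ) = 1 / 4 := by norm_num
  rw [h14]
  have hba : 0 ≤ b - a := sub_nonneg.2 hab
  have hb' : 0 ≤ -b := neg_nonneg.2 hb
  have hsub : (-a) ^ (1 / 4 : ℝ) ≤ (-b) ^ (1 / 4 : ℝ) + (b - a) ^ (1 / 4 : ℝ) := by
    rw [show -a = -b + (b - a) by ring]
    exact Real.rpow_add_le_add_rpow hb' hba (by norm_num) (by norm_num)
  have : ((-a) ^ (1 / 4 : ℝ) - (-b) ^ (1 / 4 : ℝ)) / (1 / 4) =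
      4 * ((-a) ^ (1 / 4 : ℝ) - (-b) ^ (1 / 4 : ℝ)) := by ring
  rw [this]
  linarith

/-- **Integration of the slice bound over a unit parabolic ball below `t = 0`.** If for every time
`τ ∈ (t − 1, t)` of the ball `Q(z, 1)`, `z = (t, x)`, `t ≤ 0`, the slice integral of `F` over
`B₁(x)` is at most `a (−τ)^{-3/4} + b` (`a, b ≥ 0`), then `∫_{Q(z,1)} F ≤ 4a + b`
(Tonelli, `∫_{t-1}^{t} (−τ)^{-3/4} dτ ≤ 4`). [folklore] -/
theorem lintegral_unitCylinder_le_of_slice {F : ℝ → EuclideanSpace ℝ (Fin 3) → ℝ≥0∞}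
    {z : ℝ × EuclideanSpace ℝ (Fin 3)} (hz : z.1 ≤ 0) {a b : ℝ} (ha : 0 ≤ a) (hb : 0 ≤ b)
    (hslice : ∀ τ ∈ Ioo (z.1 - 1) z.1,
      ∫⁻ x in ball z.2 1, F τ x ≤ ENNReal.ofReal (a * (-τ) ^ (-(3 / 4) : ℝ) + b)) :
    ∫⁻ w in parabolicCylinder 1 z, F w.1 w.2 ≤ ENNReal.ofReal (4 * a + b) := by
  set I : Set ℝ := Ioo (z.1 - 1) z.1 with hI
  have hIeq : Ioo (z.1 - 1 ^ 2) z.1 = I := by rw [one_pow]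
  -- Tonelli (inequality form)
  have hprod : ∫⁻ w in parabolicCylinder 1 z, F w.1 w.2 ≤ ∫⁻ τ in I, ∫⁻ x in ball z.2 1, F τ x := by
    have e : (volume : Measure (ℝ × EuclideanSpace ℝ (Fin 3))).restrict (parabolicCylinder 1 z) =
        ((volume : Measure ℝ).restrict I).prod
          ((volume : Measure (EuclideanSpace ℝ (Fin 3))).restrict (ball z.2 1)) := by
      rw [show parabolicCylinder 1 z = I ×ˢ ball z.2 1 by rw [← hIeq]; rfl, Measure.volume_eq_prod,
        Measure.prod_restrict]
    rw [e]
    exact lintegral_prod_le _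
  refine hprod.trans ?_
  have hmono : ∫⁻ τ in I, ∫⁻ x in ball z.2 1, F τ x ≤
      ∫⁻ τ in I, ENNReal.ofReal (a * (-τ) ^ (-(3 / 4) : ℝ) + b) :=
    setLIntegral_mono' measurableSet_Ioo fun τ hτ => hslice τ hτ
  refine hmono.trans ?_
  -- integrate the majorant
  have hab : z.1 - 1 ≤ z.1 := by linarith
  have hii : IntervalIntegrable (fun τ : ℝ => (-τ) ^ (-(3 / 4) : ℝ)) volume (z.1 - 1) z.1 := by
    have h1 : IntervalIntegrable (fun σ : ℝ => σ ^ (-(3 / 4) : ℝ)) volume (-(z.1 - 1)) (-z.1) :=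
      intervalIntegral.intervalIntegrable_rpow' (by norm_num)
    have h2 := (IntervalIntegrable.iff_comp_neg (f := fun σ : ℝ => σ ^ (-(3 / 4) : ℝ))
      (a := -(z.1 - 1)) (b := -z.1)).mp h1
    simpa only [neg_neg] using h2
  have hint : IntegrableOn (fun τ : ℝ => (-τ) ^ (-(3 / 4) : ℝ)) I volume :=
    ((intervalIntegrable_iff_integrableOn_Ioc_of_le hab).1 hii).mono_set Ioo_subset_Ioc_self
  have hnn : ∀ τ ∈ I, 0 ≤ (-τ) ^ (-(3 / 4) : ℝ) := fun τ hτ =>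
    Real.rpow_nonneg (by linarith [hτ.2]) _
  have hintg : IntegrableOn (fun τ : ℝ => a * (-τ) ^ (-(3 / 4) : ℝ) + b) I volume :=
    (hint.const_mul a).add (integrableOn_const (by rw [Real.volume_Ioo]; exact ENNReal.ofReal_ne_top))
  have hvolI : volume.real I = 1 := by
    rw [measureReal_def, Real.volume_Ioo, show z.1 - (z.1 - 1) = 1 by ring, ENNReal.toReal_ofReal zero_le_one]
  calc ∫⁻ τ in I, ENNReal.ofReal (a * (-τ) ^ (-(3 / 4) : ℝ) + b)
      = ENNReal.ofReal (∫ τ in I, (a * (-τ) ^ (-(3 / 4) : ℝ) + b)) := by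
        rw [ofReal_integral_eq_lintegral_ofReal hintg]
        filter_upwards [ae_restrict_mem measurableSet_Ioo] with τ hτ
        exact add_nonneg (mul_nonneg ha (hnn τ hτ)) hb
    _ ≤ ENNReal.ofReal (4 * a + b) := by
        refine ENNReal.ofReal_le_ofReal ?_
        rw [integral_add (hint.const_mul a) (integrableOn_const (by
          rw [Real.volume_Ioo]; exact ENNReal.ofReal_ne_top)), integral_const_mul, setIntegral_const,
          hvolI, one_smul]
        have hI4 : ∫ τ in I, (-τ) ^ (-(3 / 4) : ℝ) ≤ 4 := by
          calc ∫ τ in I, (-τ) ^ (-(3 / 4) : ℝ)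
              = ∫ τ in Ioc (z.1 - 1) z.1, (-τ) ^ (-(3 / 4) : ℝ) := setIntegral_congr_set Ioo_ae_eq_Ioc
            _ = ∫ τ in (z.1 - 1)..z.1, (-τ) ^ (-(3 / 4) : ℝ) := (intervalIntegral.integral_of_le hab).symm
            _ ≤ 4 * (z.1 - (z.1 - 1)) ^ (1 / 4 : ℝ) := integral_rpow_neg_threeQuarters_le hab hz
            _ = 4 := by rw [show z.1 - (z.1 - 1) = 1 by ring, Real.one_rpow, mul_one]
        nlinarith


end Summit.NavierStokesRegularity.NavierStokesRegularity.Theorems.AxisymEndLiouvilleOfFarPastLedger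

end
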